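import Mathlib.Analysis.SpecialFunctions.Complex.Arg
import Literature.Probability.LatticeModels.TriangularLatticeProofs
import Literature.Probability.LatticeModels.IsoradialPercolationProofs
import Literature.Probability.Percolation.StarTriangleIsoradial
import HarnessLib

/-!
# The triangular lattice as an isoradial graph (rhombille diamond graph, canonical measure `P_{p_c}`)

Topic `Literature/Probability/LatticeModels`. Grimmett–Manolescu, *Bond percolation on isoradial
graphs: criticality and universality*, PTRF **159** (2014) 273–327 = arXiv:1204.0505, §1 and
§2.1–2.2: an isoradial graph is a planar graph embedded so that every face is inscribed in a
circle of radius `1` centred inside the face; its diamond graph `G^◇` has the vertices and the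
face centres as vertices and the unit corner–centre segments as edges, every edge `e` of `G`
being a diagonal of a rhombus of `G^◇` with half-angle `θ_e`; the *canonical* bond percolation
measure `P_G` opens `e` with probability `p_e`, `p_e/(1 − p_e) = sin(θ̂_e/3)/sin((π − θ̂_e)/3)`
((1.3)/(2.2)); the class `𝒢` "includes … the triangular and hexagonal lattices" (§1; the
inhomogeneous versions are Grimmett–Manolescu, Ann. Probab. 41 (2013), §1.4, "each may be regarded
as percolation on an isoradial graph with edge-parameters chosen in the canonical way").

This file realises the (homogeneous) triangular lattice `𝕋 = triGraph` of the tree as such a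
graph, in the vocabulary of `IsoradialGraphs` / `IsoradialPercolation` and in the normalisation
used by route `CardyBondTriangular` of `CriticalPhenomena/CardyFormulaZ2` (item
`TriIsoradialInstance`): vertices at `√3 (triEmbed x − (1 + ζ)/3)` (unit circumradius: the
equilateral faces of `triEmbed` have circumradius `1/√3`; the up-triangle of the cell `0` is
centred at the origin), faces `HexVertex` (the tree's hexagonal dual) centred at
`√3 (hexCenter f − (1 + ζ)/3)`, left/right faces of a dart read off `triEdgeFaces`.

## Contents (all proved)

* `triIsoradialEmbedding` and its field lemmas (`_z`, `_c`, `_leftFace`, `_rightFace`);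
* `hexCenter_triEdgeFaces_fst/snd` — the centre of the face to the left (right) of a dart
  `x → y` is `triEmbed x + (triEmbed y − triEmbed x) · e^{± iπ/6}/√3` (`triLeftRatio`,
  `triRightRatio`);
* `triIsoradialEmbedding_isIsoradial` — unit corner–centre distances, left/right exchanged by
  reversal, non-degenerate rhombi, injective drawing (GM14 §2.1);
* `triIsoradialEmbedding_halfAngle` — every rhombus half-angle is `π/6` (the rhombille tiling:
  rhombi with angles `π/3` at the vertices of `𝕋` and `2π/3` at the face centres), whence
  `triIsoradialEmbedding_hasBoundedAngles : HasBoundedAngles (π/6)` (BAP, GM14 §2.1 (2.1));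
* `triIsoradialEmbedding_isoradialPercolation` — the canonical measure is critical bond
  percolation `bondPercolation triGraph (criticalWeightI (π/6))`, `criticalWeight (π/6) =
  2 sin(π/18) = p_c^bond(𝕋)` (`criticalWeight_pi_div_six`, `StarTriangleIsoradial`; GM14 (1.3),
  GM13 §1.2 (2): `3p − p³ = 1`);
* `triIsoradialEmbedding_z_ne_c` — no vertex is drawn at a face centre (the "no-clash"
  hypothesis of the tree's planar-duality files `IsoradialDualityExclusion`,
  `IsoradialBoxCrossingAssembly`).

Not here (recorded for the sequel): the rhombic-tiling condition `IsRhombicTiling` (disjoint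
rhombus interiors, covering) and the square-grid property (`HasSquareGridProperty`, printed form
`HasSquareGridPropertyGM`: two of the three parallel track families of the rhombille tiling form
the grid, the third family crossing both in order), which complete `𝕋 ∈ 𝒢`.

## References

* G. R. Grimmett, I. Manolescu, PTRF 159 (2014) 273–327, arXiv:1204.0505: §1 (isoradial graphs,
  (1.3), the class `𝒢` includes the triangular lattice), §2.1 (Def. 2.1 BAP(ε), rhombic tilings),
  §2.2 ((2.2)–(2.3), the canonical measure).
* G. R. Grimmett, I. Manolescu, Ann. Probab. 41 (2013) 2990–3025, arXiv:1105.5535: §1.2 eq. (2),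
  §1.4 (highly inhomogeneous models as isoradial percolation).
* R. Kenyon, *The Laplacian and Dirac operators on critical planar graphs*, Invent. Math. 150
  (2002), §1 (isoradial embeddings; the triangular/hexagonal example).
-/

noncomputable section

open Complex

namespace Literature.Probability.LatticeModels

/-! ### The embedding -/

/-- **The triangular lattice as an isoradial graph** (rhombic / diamond-graph data of
`IsoradialGraphs`): the vertex `x` of `𝕋 = triGraph` is drawn at `√3 (triEmbed x − (1 + ζ)/3)`
(equilateral faces of side `√3`, unit circumradius, the up-triangle of the cell `0` centred at
the origin), the face `f : HexVertex` (a triangle of `𝕋`, i.e. a vertex of the hexagonal dual) at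
its circumcentre `√3 (hexCenter f − (1 + ζ)/3)`, and the faces to the left / right of a dart are
`triEdgeFaces`. (Grimmett–Manolescu 2014, §1 and §2.1: "[`𝒢`] includes … the triangular and
hexagonal lattices"; Kenyon 2002, §1.) [cite: GrimmettManolescu2014Isoradial, §1 (isoradial graphs; 𝒢 includes the triangular lattice) and §2.1] -/
def triIsoradialEmbedding : RhombicEmbedding triGraph HexVertex where
  z x := (Real.sqrt 3 : ℂ) * (triEmbed x - (1 + triZeta) / 3)
  c f := (Real.sqrt 3 : ℂ) * (hexCenter f - (1 + triZeta) / 3)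
  leftFace d := (triEdgeFaces d).1
  rightFace d := (triEdgeFaces d).2

/-- The drawing of `triIsoradialEmbedding` (the normalisation of route `CardyBondTriangular`).
[cite: GrimmettManolescu2014Isoradial, §2.1] -/
theorem triIsoradialEmbedding_z :
    triIsoradialEmbedding.z = fun x : Site 2 => (Real.sqrt 3 : ℂ) * (triEmbed x - (1 + triZeta) / 3) :=
  rfl

/-- The face centres of `triIsoradialEmbedding`. [cite: GrimmettManolescu2014Isoradial, §2.1] -/
theorem triIsoradialEmbedding_c (f : HexVertex) :
    triIsoradialEmbedding.c f = (Real.sqrt 3 : ℂ) * (hexCenter f - (1 + triZeta) / 3) :=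
  rfl

/-- The left face of a dart of `triIsoradialEmbedding`. [cite: GrimmettManolescu2014Isoradial, §2.1] -/
theorem triIsoradialEmbedding_leftFace (d : triGraph.Dart) :
    triIsoradialEmbedding.leftFace d = (triEdgeFaces d).1 :=
  rfl

/-- The right face of a dart of `triIsoradialEmbedding`. [cite: GrimmettManolescu2014Isoradial, §2.1] -/
theorem triIsoradialEmbedding_rightFace (d : triGraph.Dart) :
    triIsoradialEmbedding.rightFace d = (triEdgeFaces d).2 :=
  rfl

/-! ### The face centres beside a dart -/

/-- `e^{iπ/6}/√3 = 1/2 + i √3/6`: the centroid of the unit equilateral triangle to the left of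
the unit vector `u`, seen from its tail, is `u · e^{iπ/6}/√3`. [folklore] -/
def triLeftRatio : ℂ := ⟨1 / 2, Real.sqrt 3 / 6⟩

/-- `e^{-iπ/6}/√3 = 1/2 − i √3/6` (the triangle to the right). [folklore] -/
def triRightRatio : ℂ := ⟨1 / 2, -(Real.sqrt 3 / 6)⟩

/-- Real part of `triLeftRatio`. [folklore] -/
@[simp] theorem triLeftRatio_re : triLeftRatio.re = 1 / 2 := rfl
/-- Imaginary part of `triLeftRatio`. [folklore] -/
@[simp] theorem triLeftRatio_im : triLeftRatio.im = Real.sqrt 3 / 6 := rfl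
/-- Real part of `triRightRatio`. [folklore] -/
@[simp] theorem triRightRatio_re : triRightRatio.re = 1 / 2 := rfl
/-- Imaginary part of `triRightRatio`. [folklore] -/
@[simp] theorem triRightRatio_im : triRightRatio.im = -(Real.sqrt 3 / 6) := rfl

/-- The faces to the left and to the right of the dart `0 → v` (as computed by `triFace`, cf.
`triEdgeFaces`), for each of the six directions `v`, by `decide`. [folklore] -/
private theorem triFace_dir_e0 :
    triFace 0 (Pi.single 0 1) (triRot60 (Pi.single 0 1)) = ((0 : Site 2), (0 : Fin 2)) ∧
      triFace 0 (Pi.single 0 1) (triRotNeg60 (Pi.single 0 1)) = (-Pi.single 1 1, 1) := by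
  decide

/-- The two faces of the dart `0 → -e₀`. [folklore] -/
private theorem triFace_dir_ne0 :
    triFace 0 (-Pi.single 0 1) (triRot60 (-Pi.single 0 1)) =
        (-(Pi.single 0 1 + Pi.single 1 1), (1 : Fin 2)) ∧
      triFace 0 (-Pi.single 0 1) (triRotNeg60 (-Pi.single 0 1)) = (-Pi.single 0 1, 0) := by
  decide

/-- The two faces of the dart `0 → e₁`. [folklore] -/
private theorem triFace_dir_e1 :
    triFace 0 (Pi.single 1 1) (triRot60 (Pi.single 1 1)) = (-Pi.single 0 1, (1 : Fin 2)) ∧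
      triFace 0 (Pi.single 1 1) (triRotNeg60 (Pi.single 1 1)) = ((0 : Site 2), 0) := by
  decide

/-- The two faces of the dart `0 → -e₁`. [folklore] -/
private theorem triFace_dir_ne1 :
    triFace 0 (-Pi.single 1 1) (triRot60 (-Pi.single 1 1)) = (-Pi.single 1 1, (0 : Fin 2)) ∧
      triFace 0 (-Pi.single 1 1) (triRotNeg60 (-Pi.single 1 1)) =
        (-(Pi.single 0 1 + Pi.single 1 1), 1) := by
  decide

/-- The two faces of the dart `0 → (1, -1)`. [folklore] -/
private theorem triFace_dir_diag :
    triFace 0 triDiag (triRot60 triDiag) = (-Pi.single 1 1, (1 : Fin 2)) ∧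
      triFace 0 triDiag (triRotNeg60 triDiag) = (-Pi.single 1 1, 0) := by
  decide

/-- The two faces of the dart `0 → (-1, 1)`. [folklore] -/
private theorem triFace_dir_ndiag :
    triFace 0 (-triDiag) (triRot60 (-triDiag)) = (-Pi.single 0 1, (0 : Fin 2)) ∧
      triFace 0 (-triDiag) (triRotNeg60 (-triDiag)) = (-Pi.single 0 1, 1) := by
  decide

/-- Translation covariance of the face centres. [folklore] -/
private theorem hexCenter_triFace_shift (x v w : Site 2) :
    hexCenter (triFace x (x + v) (x + w)) = triEmbed x + hexCenter (triFace 0 v w) := by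
  have h := triFace_add x 0 v w
  rw [add_zero] at h
  rw [h]
  simp only [hexCenter, triEmbed_add]
  ring

/-- The two face centres beside the dart `0 → v`, for the six directions. [folklore] -/
private theorem hexCenter_triFace_dir {v : Site 2}
    (hv : v ∈ ({Pi.single 0 1, -Pi.single 0 1, Pi.single 1 1, -Pi.single 1 1, triDiag, -triDiag} :
        Finset (Site 2))) :
    hexCenter (triFace 0 v (triRot60 v)) = triEmbed v * triLeftRatio ∧
      hexCenter (triFace 0 v (triRotNeg60 v)) = triEmbed v * triRightRatio := by
  have h3 : Real.sqrt 3 * Real.sqrt 3 = 3 := Real.mul_self_sqrt (by norm_num)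
  simp only [Finset.mem_insert, Finset.mem_singleton] at hv
  rcases hv with rfl | rfl | rfl | rfl | rfl | rfl
  · rw [triFace_dir_e0.1, triFace_dir_e0.2]
    constructor <;> apply Complex.ext <;>
      simp [hexCenter, triEmbed_neg, Complex.mul_re, Complex.mul_im] <;>
      nlinarith [h3]
  · rw [triFace_dir_ne0.1, triFace_dir_ne0.2]
    constructor <;> apply Complex.ext <;>
      simp [hexCenter, triEmbed_neg, triEmbed_add, Complex.mul_re, Complex.mul_im] <;>
      nlinarith [h3]
  · rw [triFace_dir_e1.1, triFace_dir_e1.2]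
    constructor <;> apply Complex.ext <;>
      simp [hexCenter, triEmbed_neg, Complex.mul_re, Complex.mul_im] <;>
      nlinarith [h3]
  · rw [triFace_dir_ne1.1, triFace_dir_ne1.2]
    constructor <;> apply Complex.ext <;>
      simp [hexCenter, triEmbed_neg, triEmbed_add, Complex.mul_re, Complex.mul_im] <;>
      nlinarith [h3]
  · rw [triFace_dir_diag.1, triFace_dir_diag.2]
    constructor <;> apply Complex.ext <;>
      simp [hexCenter, triEmbed_neg, Complex.mul_re, Complex.mul_im] <;>
      nlinarith [h3]
  · rw [triFace_dir_ndiag.1, triFace_dir_ndiag.2]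
    constructor <;> apply Complex.ext <;>
      simp [hexCenter, triEmbed_neg, Complex.mul_re, Complex.mul_im] <;>
      nlinarith [h3]

/-- **The centre of the face to the left of a dart** `x → y` of `𝕋` is
`triEmbed x + (triEmbed y − triEmbed x) · e^{iπ/6}/√3` (the centroid of the unit equilateral
triangle on the left of the edge). (Grimmett 1999, §1.6, Fig. 1.7; Werner 2009, §1.) [folklore] -/
theorem hexCenter_triEdgeFaces_fst (d : triGraph.Dart) :
    hexCenter (triEdgeFaces d).1 =
      triEmbed d.fst + (triEmbed d.snd - triEmbed d.fst) * triLeftRatio := by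
  obtain ⟨⟨x, y⟩, hxy⟩ := d
  change hexCenter (triFace x y (x + triRot60 (y - x))) =
    triEmbed x + (triEmbed y - triEmbed x) * triLeftRatio
  have hy : y ∈ triGraph.neighborFinset x := (SimpleGraph.mem_neighborFinset _ _ _).2 hxy
  rw [neighborFinset_triGraph_eq, Finset.mem_image] at hy
  obtain ⟨v, hv, rfl⟩ := hy
  rw [add_sub_cancel_left, hexCenter_triFace_shift, (hexCenter_triFace_dir hv).1, triEmbed_add]
  ring

/-- **The centre of the face to the right of a dart** `x → y` of `𝕋` is
`triEmbed x + (triEmbed y − triEmbed x) · e^{-iπ/6}/√3`. [folklore] -/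
theorem hexCenter_triEdgeFaces_snd (d : triGraph.Dart) :
    hexCenter (triEdgeFaces d).2 =
      triEmbed d.fst + (triEmbed d.snd - triEmbed d.fst) * triRightRatio := by
  obtain ⟨⟨x, y⟩, hxy⟩ := d
  change hexCenter (triFace x y (x + triRotNeg60 (y - x))) =
    triEmbed x + (triEmbed y - triEmbed x) * triRightRatio
  have hy : y ∈ triGraph.neighborFinset x := (SimpleGraph.mem_neighborFinset _ _ _).2 hxy
  rw [neighborFinset_triGraph_eq, Finset.mem_image] at hy
  obtain ⟨v, hv, rfl⟩ := hy
  rw [add_sub_cancel_left, hexCenter_triFace_shift, (hexCenter_triFace_dir hv).2, triEmbed_add]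
  ring

/-! ### Isoradiality -/

/-- `√3 · ‖w‖ = 1` when `|w|² = 1/3`. [folklore] -/
private theorem sqrt_three_mul_norm {w : ℂ} (hw : Complex.normSq w = 1 / 3) :
    Real.sqrt 3 * ‖w‖ = 1 := by
  have h : (Real.sqrt 3 * ‖w‖) ^ 2 = 1 := by
    rw [mul_pow, Complex.sq_norm, hw, Real.sq_sqrt (by norm_num)]
    norm_num
  have h0 : 0 ≤ Real.sqrt 3 * ‖w‖ := by positivity
  nlinarith [h, h0]

/-- `|e^{iπ/6}/√3|² = 1/3`. [folklore] -/
private theorem normSq_triLeftRatio : Complex.normSq triLeftRatio = 1 / 3 := by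
  have h3 : Real.sqrt 3 * Real.sqrt 3 = 3 := Real.mul_self_sqrt (by norm_num)
  rw [Complex.normSq_apply, triLeftRatio_re, triLeftRatio_im]
  nlinarith [h3]

/-- `|1 − e^{iπ/6}/√3|² = 1/3` (the other corner of the rhombus). [folklore] -/
private theorem normSq_one_sub_triLeftRatio : Complex.normSq (1 - triLeftRatio) = 1 / 3 := by
  have h3 : Real.sqrt 3 * Real.sqrt 3 = 3 := Real.mul_self_sqrt (by norm_num)
  rw [Complex.normSq_apply]
  simp only [Complex.sub_re, Complex.one_re, triLeftRatio_re, Complex.sub_im, Complex.one_im,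
    triLeftRatio_im]
  nlinarith [h3]

/-- The edges of the drawing have unit direction vectors in `triEmbed`. [folklore] -/
private theorem norm_triEmbed_dart (d : triGraph.Dart) :
    ‖triEmbed d.snd - triEmbed d.fst‖ = 1 := by
  rw [norm_sub_rev]
  exact norm_triEmbed_eq_one_of_adj d.adj

/-- `triEmbed` is injective (the lattice coordinates are read off the imaginary and real
parts). [folklore] -/
private theorem triEmbed_inj {x y : Site 2} (h : triEmbed x = triEmbed y) : x = y := by
  have h3 : (0 : ℝ) < Real.sqrt 3 / 2 := by positivity
  have hre := congrArg Complex.re h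
  have him := congrArg Complex.im h
  simp only [triEmbed, Complex.add_re, Complex.intCast_re, Complex.mul_re, triZeta_re,
    Complex.intCast_im, triZeta_im, zero_mul, sub_zero, Complex.add_im, Complex.mul_im,
    zero_add, add_zero] at hre him
  have h1 : (x 1 : ℝ) = y 1 := by nlinarith
  have h0 : (x 0 : ℝ) = y 0 := by linarith
  ext i
  fin_cases i
  · exact_mod_cast h0
  · exact_mod_cast h1

/-- **`𝕋` is isoradially embedded by `triIsoradialEmbedding`** (`RhombicEmbedding.IsIsoradial`):
for every dart `x → y` with left face centre `f`, `‖z x − c f‖ = ‖z y − c f‖ = 1` (the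
circumradius `√3 · (1/√3)`), reversing the dart exchanges left and right faces
(`triEdgeFaces_symm`), the two faces of a dart have distinct centres (`e^{iπ/6} ≠ e^{-iπ/6}`),
and the drawing is injective. (Grimmett–Manolescu 2014, §2.1: "`G` is isoradial if … each face
is inscribable in a circle of radius 1 whose centre lies in the face"; the triangular lattice is
listed among the members of `𝒢` in §1.) [cite: GrimmettManolescu2014Isoradial, §2.1 (isoradial embedding, rhombi of the diamond graph); §1 (𝒢 ∋ triangular lattice)] -/
theorem triIsoradialEmbedding_isIsoradial : triIsoradialEmbedding.IsIsoradial where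
  norm_sub_eq_one d := by
    have hL := hexCenter_triEdgeFaces_fst d
    have hu := norm_triEmbed_dart d
    have hs : ‖((Real.sqrt 3 : ℝ) : ℂ)‖ = Real.sqrt 3 := by
      rw [Complex.norm_real, Real.norm_eq_abs, abs_of_nonneg (Real.sqrt_nonneg 3)]
    change ‖(Real.sqrt 3 : ℂ) * (triEmbed d.fst - (1 + triZeta) / 3) -
          (Real.sqrt 3 : ℂ) * (hexCenter (triEdgeFaces d).1 - (1 + triZeta) / 3)‖ = 1 ∧
        ‖(Real.sqrt 3 : ℂ) * (triEmbed d.snd - (1 + triZeta) / 3) -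
          (Real.sqrt 3 : ℂ) * (hexCenter (triEdgeFaces d).1 - (1 + triZeta) / 3)‖ = 1
    rw [hL]
    have e1 : (Real.sqrt 3 : ℂ) * (triEmbed d.fst - (1 + triZeta) / 3) -
        (Real.sqrt 3 : ℂ) * (triEmbed d.fst + (triEmbed d.snd - triEmbed d.fst) * triLeftRatio -
          (1 + triZeta) / 3) =
        -((Real.sqrt 3 : ℂ) * ((triEmbed d.snd - triEmbed d.fst) * triLeftRatio)) := by ring
    have e2 : (Real.sqrt 3 : ℂ) * (triEmbed d.snd - (1 + triZeta) / 3) -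
        (Real.sqrt 3 : ℂ) * (triEmbed d.fst + (triEmbed d.snd - triEmbed d.fst) * triLeftRatio -
          (1 + triZeta) / 3) =
        (Real.sqrt 3 : ℂ) * ((triEmbed d.snd - triEmbed d.fst) * (1 - triLeftRatio)) := by ring
    rw [e1, e2, norm_neg, norm_mul, norm_mul, norm_mul, norm_mul, hu, hs, one_mul, one_mul]
    exact ⟨sqrt_three_mul_norm normSq_triLeftRatio, sqrt_three_mul_norm normSq_one_sub_triLeftRatio⟩
  leftFace_symm d := by
    change (triEdgeFaces d.symm).1 = (triEdgeFaces d).2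
    rw [triEdgeFaces_symm_holds]
    rfl
  c_leftFace_ne d := by
    have h3 : (0 : ℝ) < Real.sqrt 3 := by positivity
    have hL := hexCenter_triEdgeFaces_fst d
    have hR := hexCenter_triEdgeFaces_snd d
    have hu := norm_triEmbed_dart d
    change (Real.sqrt 3 : ℂ) * (hexCenter (triEdgeFaces d).1 - (1 + triZeta) / 3) ≠
      (Real.sqrt 3 : ℂ) * (hexCenter (triEdgeFaces d).2 - (1 + triZeta) / 3)
    rw [hL, hR]
    intro h
    have hs0 : ((Real.sqrt 3 : ℝ) : ℂ) ≠ 0 := by exact_mod_cast h3.ne'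
    have h' := mul_left_cancel₀ hs0 h
    have hu0 : triEmbed d.snd - triEmbed d.fst ≠ 0 := by
      rw [← norm_ne_zero_iff, hu]; exact one_ne_zero
    have h'' : (triEmbed d.snd - triEmbed d.fst) * triLeftRatio =
        (triEmbed d.snd - triEmbed d.fst) * triRightRatio := by
      have := congrArg (fun w => w - triEmbed d.fst + (1 + triZeta) / 3) h'
      simpa using this
    have hlr : triLeftRatio = triRightRatio := mul_left_cancel₀ hu0 h''
    have him := congrArg Complex.im hlr
    rw [triLeftRatio_im, triRightRatio_im] at him
    linarith
  z_injective := by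
    intro x y h
    have h3 : (0 : ℝ) < Real.sqrt 3 := by positivity
    have hs0 : ((Real.sqrt 3 : ℝ) : ℂ) ≠ 0 := by exact_mod_cast h3.ne'
    change (Real.sqrt 3 : ℂ) * (triEmbed x - (1 + triZeta) / 3) =
      (Real.sqrt 3 : ℂ) * (triEmbed y - (1 + triZeta) / 3) at h
    exact triEmbed_inj (sub_left_injective (mul_left_cancel₀ hs0 h))

/-! ### Angles: the rhombille tiling has all half-angles `π/6` -/

/-- `1/2 + i√3/6 = (√3/3) e^{iπ/6}`. [folklore] -/
private theorem triLeftRatio_eq_polar :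
    triLeftRatio = ((Real.sqrt 3 / 3 : ℝ) : ℂ) *
      (Complex.cos ((Real.pi / 6 : ℝ) : ℂ) + Complex.sin ((Real.pi / 6 : ℝ) : ℂ) * I) := by
  have h3 : Real.sqrt 3 * Real.sqrt 3 = 3 := Real.mul_self_sqrt (by norm_num)
  rw [← Complex.ofReal_cos, ← Complex.ofReal_sin, Real.cos_pi_div_six, Real.sin_pi_div_six]
  apply Complex.ext
  · simp [Complex.mul_re]
    nlinarith [h3]
  · simp [Complex.mul_im]
    ring

/-- **Every rhombus of `triIsoradialEmbedding` has half-angle `π/6`**: for a dart `x → y` with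
left face centre `f`, `(c f − z x)/(z y − z x) = e^{iπ/6}/√3`, whose argument is `π/6` (the
rhombille tiling: angle `π/3` at the vertices of `𝕋`, `2π/3` at the face centres; rhombus angle
`θ̂ = π/3` in GM's notation). (Grimmett–Manolescu 2014, §2.1 Fig. 2.1 and (2.2)–(2.3); Kenyon
2002, §1.) [cite: GrimmettManolescu2014Isoradial, §2.1 (rhombus angle θ_e) and §2.2 (2.2)–(2.3)] -/
theorem triIsoradialEmbedding_halfAngle (d : triGraph.Dart) :
    triIsoradialEmbedding.halfAngle d = Real.pi / 6 := by
  have h3 : (0 : ℝ) < Real.sqrt 3 := by positivity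
  have hs0 : ((Real.sqrt 3 : ℝ) : ℂ) ≠ 0 := by exact_mod_cast h3.ne'
  have hL := hexCenter_triEdgeFaces_fst d
  have hu := norm_triEmbed_dart d
  have hu0 : triEmbed d.snd - triEmbed d.fst ≠ 0 := by
    rw [← norm_ne_zero_iff, hu]; exact one_ne_zero
  unfold RhombicEmbedding.halfAngle
  change |Complex.arg (((Real.sqrt 3 : ℂ) * (hexCenter (triEdgeFaces d).1 - (1 + triZeta) / 3) -
      (Real.sqrt 3 : ℂ) * (triEmbed d.fst - (1 + triZeta) / 3)) /
      ((Real.sqrt 3 : ℂ) * (triEmbed d.snd - (1 + triZeta) / 3) -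
        (Real.sqrt 3 : ℂ) * (triEmbed d.fst - (1 + triZeta) / 3)))| = Real.pi / 6
  rw [hL]
  have e : ((Real.sqrt 3 : ℂ) * (triEmbed d.fst + (triEmbed d.snd - triEmbed d.fst) * triLeftRatio -
        (1 + triZeta) / 3) - (Real.sqrt 3 : ℂ) * (triEmbed d.fst - (1 + triZeta) / 3)) /
      ((Real.sqrt 3 : ℂ) * (triEmbed d.snd - (1 + triZeta) / 3) -
        (Real.sqrt 3 : ℂ) * (triEmbed d.fst - (1 + triZeta) / 3)) = triLeftRatio := by
    rw [div_eq_iff (by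
      rw [← mul_sub]
      exact mul_ne_zero hs0 (by
        rw [show triEmbed d.snd - (1 + triZeta) / 3 - (triEmbed d.fst - (1 + triZeta) / 3) =
          triEmbed d.snd - triEmbed d.fst by ring]
        exact hu0))]
    ring
  rw [e, triLeftRatio_eq_polar, Complex.arg_mul_cos_add_sin_mul_I (by positivity)
    ⟨by linarith [Real.pi_pos], by linarith [Real.pi_pos]⟩]
  exact abs_of_pos (by positivity)

/-- **`𝕋` has the bounded-angles property BAP(`π/6`)** (`RhombicEmbedding.HasBoundedAngles`):
every half-angle equals `π/6 ∈ [π/6, π/2 − π/6]`. (Grimmett–Manolescu 2014, §2.1, Def. 2.1 /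
(2.1).) [cite: GrimmettManolescu2014Isoradial, §2.1 Def. 2.1 (bounded-angles property)] -/
theorem triIsoradialEmbedding_hasBoundedAngles :
    triIsoradialEmbedding.HasBoundedAngles (Real.pi / 6) := fun d => by
  rw [triIsoradialEmbedding_halfAngle]
  constructor <;> linarith [Real.pi_pos]

/-! ### The canonical measure is critical bond percolation on `𝕋` -/

/-- The canonical edge weights of `triIsoradialEmbedding`: `criticalWeightI (π/6)` (`= 2 sin(π/18)`,
`criticalWeight_pi_div_six`) on every edge of `𝕋` and `0` on non-edges.
(Grimmett–Manolescu 2014, (1.3)/(2.2).) [cite: GrimmettManolescu2014Isoradial, §1 (1.3) and §2.2 (2.2)] -/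
theorem triIsoradialEmbedding_edgeWeight (e : Sym2 (Site 2)) :
    triIsoradialEmbedding.edgeWeight e =
      if e ∈ triGraph.edgeSet then criticalWeightI (Real.pi / 6) else 0 := by
  unfold RhombicEmbedding.edgeWeight
  split_ifs with h
  · rw [triIsoradialEmbedding_halfAngle]
  · rfl

/-- **The canonical measure of the isoradial triangular lattice is critical bond percolation on
`𝕋`**: `P_G = bondPercolation triGraph (criticalWeightI (π/6))`, the product measure opening every
edge with probability `p_{π/3} = 2 sin(π/18)`, the root of `3p − p³ = 1` (`kappa_triangular`).
(Grimmett–Manolescu 2014, §1 (1.3) and §2.2; Grimmett–Manolescu 2013, §1.2 (2) and §1.4.)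
[cite: GrimmettManolescu2014Isoradial, §2.2 (canonical measure P_G, (2.2)–(2.3)); GrimmettManolescuAOP2013 §1.4 (lattice models as isoradial percolation)] -/
theorem triIsoradialEmbedding_isoradialPercolation :
    triIsoradialEmbedding.isoradialPercolation =
      Percolation.bondPercolation triGraph (criticalWeightI (Real.pi / 6)) := by
  unfold RhombicEmbedding.isoradialPercolation Percolation.bondPercolation
  have h : triIsoradialEmbedding.edgeWeight =
      fun e => if e ∈ triGraph.edgeSet then criticalWeightI (Real.pi / 6) else 0 :=
    funext triIsoradialEmbedding_edgeWeight
  rw [h]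
  exact prodBernoulli_indicator_holds _ _

/-! ### No vertex is drawn at a face centre -/

/-- **No clash between vertices and face centres**: `z x ≠ c f` for every vertex `x` and face
`f` (the second lattice coordinate of a face centre is a third-integer, never an integer). This
is the hypothesis `hclash` of the tree's planar-duality theorems for rhombic tilings
(`IsoradialDualityExclusion`, `IsoradialBoxCrossingAssembly`). [folklore] -/
theorem triIsoradialEmbedding_z_ne_c (x : Site 2) (f : HexVertex) :
    triIsoradialEmbedding.z x ≠ triIsoradialEmbedding.c f := by
  have h3 : (0 : ℝ) < Real.sqrt 3 := by positivity
  have hs0 : ((Real.sqrt 3 : ℝ) : ℂ) ≠ 0 := by exact_mod_cast h3.ne'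
  change (Real.sqrt 3 : ℂ) * (triEmbed x - (1 + triZeta) / 3) ≠
    (Real.sqrt 3 : ℂ) * (hexCenter f - (1 + triZeta) / 3)
  intro h
  have h' : triEmbed x = hexCenter f := sub_left_injective (mul_left_cancel₀ hs0 h)
  obtain ⟨y, t⟩ := f
  have him := congrArg Complex.im h'
  simp only [triEmbed, hexCenter, Complex.add_im, Complex.intCast_im, Complex.mul_im,
    Complex.intCast_re, triZeta_im, triZeta_re, zero_mul, zero_add, add_zero,
    Complex.div_ofNat_im, Complex.one_im, Complex.one_re,
    Complex.natCast_re, Complex.natCast_im, Complex.add_re] at him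
  have key : (3 : ℝ) * x 1 = 3 * y 1 + ((t : ℕ) + 1) := by nlinarith
  have key' : (3 : ℤ) * x 1 = 3 * y 1 + ((t : ℕ) + 1) := by exact_mod_cast key
  have ht := t.isLt
  omega

/-- The dart form of `triIsoradialEmbedding_z_ne_c`, literally the `hclash` hypothesis of
`IsoradialDualityExclusion` / `IsoradialBoxCrossingAssembly`. [folklore] -/
theorem triIsoradialEmbedding_noClash (d D : triGraph.Dart) :
    triIsoradialEmbedding.z d.fst ≠ triIsoradialEmbedding.c (triIsoradialEmbedding.leftFace D) :=
  triIsoradialEmbedding_z_ne_c _ _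

end Literature.Probability.LatticeModels

end
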